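import Literature.AnabelianGeometry.EtaleTheta.SettingModelDeltaThetaInt
import Literature.AnabelianGeometry.EtaleTheta.SettingModelKummerDataEmpty
import Literature.AnabelianGeometry.EtaleTheta.ThetaCyclotomes
import HarnessLib

/-!
# The mod-`2` Tate-twist datum `CyclotomeMod l 2` IS inhabited at the root model (sharpness of the
# emptiness certificate; proof-only)

Mochizuki, *The étale theta function …*, Publ. RIMS **45** (2009) [EtTh], Def. 2.13 p. 46 "the natural
isomorphism `μ_N ≅ (l·Δ_Θ) ⊗ (ℤ/Nℤ)`" [cite: MochizukiEtTh2009, Def 2.13 p.46]; §1 p. 17 (`Ÿ → Y`, the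
`μ₂`-level double covering on which `Θ̈` lives). PROOF-ONLY file of the abc-iut cell (prover abc-iut-w5-d125
gen 3; NV-L2 row «CyclotomeMod / CyclotomeTower at ThetaSetting.model p», positive complement).

`SettingModelCyclotomeModEmpty.lean` (abc-iut-w5-d125) certifies `CyclotomeMod l N = ∅` at the root model
for `p² ∣ N` (the twist is invisible to an untwisted `Δ_Θ`, but `G_{ℚ_p}` moves `μ_{p²}`). THIS FILE shows the
certificate is SHARP at the bottom of the tower: since `μ₂ = {±1} ⊆ ℚ_p` is FIXED by `G_{ℚ_p}`, an untwisted
`Δ_Θ ≅ ℤ` (`exists_mulEquiv_deltaTheta_int`) DOES carry the level-`2` identification —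

* `SettingModel.nonempty_cyclotomeMod_two_model (hl : l ≠ 0) : Nonempty ((ThetaSetting.model p).CyclotomeMod l 2)`
  — `red : l·Δ_Θ = lℤ → μ₂`, `c^{l·k} ↦ (−1)^k`: onto, kernel the squares `2l·ℤ`, continuous (discrete),
  equivariant (both actions trivial: abc-iut-w5-d171's `toTheta_conj_eq_of_mem_deltaTheta`; `σ(±1) = ±1`);
* `SettingModel.nonempty_cyclotomeMod_one_model` — the level-`1` identification (trivially);
* `SettingModel.galMuN_two_apply` — `G_{ℚ_p}` fixes `μ₂(ℚ̄_p)` pointwise (classical).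

So at the root model the Tate-twist data exist EXACTLY at the levels where no twist is visible; the
obstruction certified in `SettingModelCyclotomeModEmpty.lean` is a `p²`-level phenomenon. HONEST FRAMING: a
statement about the degenerate model; nothing asserts that abc is proved or refuted; no side is taken on
[IUTchIII] Cor. 3.12; typed ≠ proved; inhabited ≠ endorsed.
-/

noncomputable section

namespace Literature.AnabelianGeometry.EtaleTheta.SettingModel

open ThetaSetting Literature.AnabelianGeometry.SemiGraphs
open scoped commutatorElement

variable (p : ℕ) [hp : Fact p.Prime]

/-! ### `G_{ℚ_p}` fixes `μ₂ = {±1}` -/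

/-- An element of `μ₂(ℚ̄_p)` is `1` or `-1` in `ℚ̄_p`. [folklore] -/
private theorem coe_MuN_two (u : MuN p 2) :
    (((u : (PadicAlgCl p)ˣ)) : PadicAlgCl p) = 1 ∨ (((u : (PadicAlgCl p)ˣ)) : PadicAlgCl p) = -1 := by
  have h2 : ((u : (PadicAlgCl p)ˣ)) ^ 2 = 1 := (mem_rootsOfUnity _ _).mp u.2
  have h : (((u : (PadicAlgCl p)ˣ)) : PadicAlgCl p) * (((u : (PadicAlgCl p)ˣ)) : PadicAlgCl p) = 1 := by
    rw [← pow_two, ← Units.val_pow_eq_pow_val, h2, Units.val_one]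
  exact mul_self_eq_one_iff.mp h

/-- **`G_{ℚ_p}` acts trivially on `μ₂(ℚ̄_p) = {±1}`** (the mod-`2` cyclotomic character is trivial).
[cite: MochizukiEtTh2009, Def 2.10 p.44] -/
theorem galMuN_two_apply (σ : GQp p) (u : MuN p 2) : galMuN p 2 σ u = u := by
  apply Subtype.ext
  apply Units.ext
  rw [galMuN_apply_coe]
  rcases coe_MuN_two p u with h | h
  · rw [h, map_one]
  · rw [h, map_neg, map_one]

/-- The element `-1 ∈ μ₂(ℚ̄_p)`. [folklore] -/
private theorem neg_one_mem_rootsOfUnity_two : (-1 : (PadicAlgCl p)ˣ) ∈ rootsOfUnity 2 (PadicAlgCl p) := by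
  rw [mem_rootsOfUnity]
  exact neg_one_sq

/-- `-1 ≠ 1` in `μ₂(ℚ̄_p)` (characteristic `0`). [folklore] -/
private theorem negOne_ne_one :
    (⟨-1, neg_one_mem_rootsOfUnity_two p⟩ : MuN p 2) ≠ 1 := by
  intro h
  have h1 : (((-1 : (PadicAlgCl p)ˣ)) : PadicAlgCl p) = 1 := by
    have := congrArg (fun u : MuN p 2 => (((u : (PadicAlgCl p)ˣ)) : PadicAlgCl p)) h
    simpa using this
  rw [Units.val_neg, Units.val_one] at h1
  exact two_ne_zero (by linear_combination -h1 : (2 : PadicAlgCl p) = 0)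

/-- Integer powers of `-1 ∈ μ₂`: `(-1)^k = 1 ↔ 2 ∣ k`. [folklore] -/
private theorem negOne_zpow_eq_one_iff (k : ℤ) :
    (⟨-1, neg_one_mem_rootsOfUnity_two p⟩ : MuN p 2) ^ k = 1 ↔ (2 : ℤ) ∣ k := by
  set ε : MuN p 2 := ⟨-1, neg_one_mem_rootsOfUnity_two p⟩ with hε
  have hε2 : ε ^ (2 : ℤ) = 1 := by
    rw [show (2 : ℤ) = ((2 : ℕ) : ℤ) from rfl, zpow_natCast]
    apply Subtype.ext
    rw [SubgroupClass.coe_pow, hε, OneMemClass.coe_one]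
    exact neg_one_sq
  obtain ⟨j, rfl | rfl⟩ := Int.even_or_odd' k
  · refine ⟨fun _ => ⟨j, rfl⟩, fun _ => ?_⟩
    rw [zpow_mul, hε2, one_zpow]
  · refine ⟨fun h => ?_, fun h => ?_⟩
    · rw [zpow_add, zpow_mul, hε2, one_zpow, one_mul, zpow_one] at h
      exact (negOne_ne_one p h).elim
    · omega

/-! ### `CyclotomeMod l 2` at the root model -/

/-- **`CyclotomeMod l 2` is INHABITED at the root model** (`l ≠ 0`): with `e : Δ_Θ(model) ≃* ℤ`
(`exists_mulEquiv_deltaTheta_int`), `l·Δ_Θ = l·ℤ` and `red : l·k ↦ (-1)^k ∈ μ₂` is onto with kernel the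
squares, continuous (discrete `(Π^tp_X)^Θ`) and equivariant — both actions are trivial (`Δ_Θ` central,
abc-iut-w5-d171; `μ₂ ⊆ ℚ_p`). Sharpness of `isEmpty_cyclotomeMod_model` (which needs `p² ∣ N`).
[cite: MochizukiEtTh2009, Def 2.13 p.46] -/
theorem nonempty_cyclotomeMod_two_model (l : ℕ) (hl : l ≠ 0) :
    Nonempty ((ThetaSetting.model p).CyclotomeMod l 2) := by
  obtain ⟨e, -⟩ := exists_mulEquiv_deltaTheta_int p
  set D := ThetaSetting.model p with hD
  set ε : MuN p 2 := ⟨-1, neg_one_mem_rootsOfUnity_two p⟩ with hε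
  have hl0 : (l : ℤ) ≠ 0 := by exact_mod_cast hl
  -- the `ℤ`-coordinate of `l·Δ_Θ` and its divisibility by `l`
  let m : D.lDeltaTheta l → ℤ := fun x => Multiplicative.toAdd (e ⟨x.1, D.lDeltaTheta_le l x.2⟩)
  have hm_mul : ∀ x y : D.lDeltaTheta l, m (x * y) = m x + m y := fun x y => by
    show Multiplicative.toAdd (e ⟨(x * y : D.lDeltaTheta l).1, _⟩) = _
    have : (⟨(x * y : D.lDeltaTheta l).1, D.lDeltaTheta_le l (x * y).2⟩ : D.DeltaTheta) =
        ⟨x.1, D.lDeltaTheta_le l x.2⟩ * ⟨y.1, D.lDeltaTheta_le l y.2⟩ := rfl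
    rw [this, map_mul, toAdd_mul]
  have hm_dvd : ∀ x : D.lDeltaTheta l, (l : ℤ) ∣ m x := by
    rintro ⟨x, y, hy, rfl⟩
    refine ⟨Multiplicative.toAdd (e ⟨y, hy⟩), ?_⟩
    show Multiplicative.toAdd (e ⟨y ^ l, _⟩) = _
    have : (⟨y ^ l, D.lDeltaTheta_le l ⟨y, hy, rfl⟩⟩ : D.DeltaTheta) = ⟨y, hy⟩ ^ l := rfl
    rw [this, map_pow, toAdd_pow, nsmul_eq_mul]
  have hm_inj : ∀ x y : D.lDeltaTheta l, m x = m y → x = y := fun x y h => by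
    have h' : e ⟨x.1, D.lDeltaTheta_le l x.2⟩ = e ⟨y.1, D.lDeltaTheta_le l y.2⟩ :=
      Multiplicative.toAdd.injective h
    have h'' := congrArg Subtype.val (e.injective h')
    exact Subtype.ext h''
  -- `red x := ε ^ (m x / l)`
  let red : D.lDeltaTheta l →* MuN p 2 :=
    { toFun := fun x => ε ^ (m x / l)
      map_one' := by
        have : m 1 = 0 := by
          show Multiplicative.toAdd (e ⟨(1 : D.lDeltaTheta l).1, _⟩) = 0
          have h1 : (⟨(1 : D.lDeltaTheta l).1, D.lDeltaTheta_le l (1 : D.lDeltaTheta l).2⟩ :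
            D.DeltaTheta) = 1 := rfl
          rw [h1, map_one, toAdd_one]
        simp only [this, Int.zero_ediv, zpow_zero]
      map_mul' := fun x y => by
        obtain ⟨a, ha⟩ := hm_dvd x
        obtain ⟨b, hb⟩ := hm_dvd y
        simp only [hm_mul, ha, hb, ← mul_add, Int.mul_ediv_cancel_left _ hl0, zpow_add] }
  have hred : ∀ x, red x = ε ^ (m x / l) := fun _ => rfl
  -- the generator `c^l` of `l·Δ_Θ`, with `m = l`
  obtain ⟨c, hc1⟩ : ∃ c : D.DeltaTheta, Multiplicative.toAdd (e c) = 1 :=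
    ⟨e.symm (Multiplicative.ofAdd 1), by simp⟩
  have hcl : (c.1 ^ l) ∈ D.lDeltaTheta l := ⟨c.1, c.2, rfl⟩
  have hmcl : m ⟨c.1 ^ l, hcl⟩ = l := by
    show Multiplicative.toAdd (e ⟨c.1 ^ l, _⟩) = l
    have : (⟨c.1 ^ l, D.lDeltaTheta_le l hcl⟩ : D.DeltaTheta) = c ^ l := rfl
    rw [this, map_pow, toAdd_pow, nsmul_eq_mul, hc1, mul_one]
  haveI : DiscreteTopology D.GtpTheta := QuotientGroup.discreteTopology (isOpen_discrete _)
  refine ⟨{ red := red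
            red_surjective := ?_
            red_ker := ?_
            continuous_red := continuous_of_discreteTopology
            red_conj := ?_ }⟩
  · -- onto `μ₂ = {1, ε}`
    intro u
    rcases coe_MuN_two p u with h | h
    · refine ⟨1, ?_⟩
      rw [map_one]
      apply Subtype.ext; apply Units.ext
      rw [h]; rfl
    · refine ⟨⟨c.1 ^ l, hcl⟩, ?_⟩
      rw [hred, hmcl, Int.ediv_self hl0, zpow_one]
      apply Subtype.ext; apply Units.ext
      rw [h]; rfl
  · -- kernel = squares
    intro x
    rw [hred, negOne_zpow_eq_one_iff]
    obtain ⟨a, ha⟩ := hm_dvd x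
    rw [ha, Int.mul_ediv_cancel_left _ hl0]
    constructor
    · rintro ⟨j, rfl⟩
      -- `x = y^2` with `y := (c^j)^l`
      refine ⟨⟨(c.1 ^ j) ^ l, ⟨c.1 ^ j, Subgroup.zpow_mem _ c.2 j, rfl⟩⟩, hm_inj _ _ ?_⟩
      rw [ha]
      show _ = m ((⟨(c.1 ^ j) ^ l, ⟨c.1 ^ j, Subgroup.zpow_mem _ c.2 j, rfl⟩⟩ : D.lDeltaTheta l) ^ 2)
      rw [pow_two, hm_mul]
      have hmj : m ⟨(c.1 ^ j) ^ l, ⟨c.1 ^ j, Subgroup.zpow_mem _ c.2 j, rfl⟩⟩ = l * j := by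
        show Multiplicative.toAdd (e ⟨(c.1 ^ j) ^ l, _⟩) = _
        have : (⟨(c.1 ^ j) ^ l, D.lDeltaTheta_le l ⟨c.1 ^ j, Subgroup.zpow_mem _ c.2 j, rfl⟩⟩ :
            D.DeltaTheta) = (c ^ j) ^ l := rfl
        rw [this, map_pow, map_zpow, toAdd_pow, toAdd_zpow, smul_eq_mul, nsmul_eq_mul, hc1, mul_one]
      rw [hmj]; ring
    · rintro ⟨y, hy⟩
      change x = y ^ 2 at hy
      have hxy : m x = m y + m y := by rw [hy, pow_two, hm_mul]
      obtain ⟨b, hb⟩ := hm_dvd y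
      refine ⟨b, ?_⟩
      have : (l : ℤ) * a = l * (b + b) := by rw [← ha, hxy, hb, mul_add]
      have := mul_left_cancel₀ hl0 this
      omega
  · -- equivariance: both actions are trivial
    intro σ x
    rw [galMuN_two_apply]
    congr 1
    apply Subtype.ext
    exact toTheta_conj_eq_of_mem_deltaTheta p _ x.1 (D.lDeltaTheta_le l x.2)

/-- **`CyclotomeMod l 1` is inhabited at the root model** (the level-`1` identification is trivial:
`μ₁ = 1`). [cite: MochizukiEtTh2009, Def 2.13 p.46] -/
theorem nonempty_cyclotomeMod_one_model (l : ℕ) :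
    Nonempty ((ThetaSetting.model p).CyclotomeMod l 1) := by
  haveI : DiscreteTopology (ThetaSetting.model p).GtpTheta :=
    QuotientGroup.discreteTopology (isOpen_discrete _)
  have h1 : ∀ u : MuN p 1, u = 1 := fun u => by
    apply Subtype.ext
    have := (mem_rootsOfUnity _ _).mp u.2
    simpa using this
  refine ⟨{ red := 1
            red_surjective := fun u => ⟨1, by rw [map_one, h1 u]⟩
            red_ker := fun x => ⟨fun _ => ⟨x, (pow_one x).symm⟩, fun _ => rfl⟩
            continuous_red := continuous_of_discreteTopology
            red_conj := fun σ x => by rw [MonoidHom.one_apply, MonoidHom.one_apply, map_one] }⟩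

/-- Census form: at the root model the level-`2` twist datum exists while the level-`p²` one does not —
`ThetaSetting + IsEtThOrigin` neither refutes nor implies the Tate-twist data uniformly in the level.
[cite: MochizukiEtTh2009, Def 2.13 p.46] -/
theorem exists_isEtThOrigin_nonempty_cyclotomeMod_two (l : ℕ) (hl : l ≠ 0) :
    ∃ D : ThetaSetting p, D.IsEtThOrigin ∧ Nonempty (D.CyclotomeMod l 2) :=
  ⟨ThetaSetting.model p, ThetaSetting.model_isEtThOrigin p, nonempty_cyclotomeMod_two_model p l hl⟩

end Literature.AnabelianGeometry.EtaleTheta.SettingModel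

end
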